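import Literature.Topology.FourManifolds.LinkKhComplex
import Literature.Topology.FourManifolds.LinkKhDSquared
import Literature.Topology.FourManifolds.KhComplexFaceProofs
import HarnessLib

/-!
# The saddle move on a link Gauss diagram: state circles (link tower, layer T4b, part 1)

The link tower `LinkGaussDiagrams` (D1: `LinkGaussDiagram`, `Arc = Fin (2n) ⊕ Fin free`, `arcOut`,
`arcIn p = inl (next⁻¹ p)`, and the Morse moves `birth`, `death`, `saddle p q :=
{L with next := next * swap p q}`) → `LinkKhResolutions` (D2a: `State`, `stateGraph`, `circleOf`,
`IsMergeAt`, `IsSplitAt`, `IsMergeAt.not_isSplitAt`, the arc-end calculus `endArc`, `endGlue`,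
`endFlip`) → `LinkKhComplex` (D2b: `EnhancedState`, `incidence`, `khovanovD`, `leeCycles`, `qMin`)
continues here with the combinatorics of the **oriented saddle** (band move) needed for its chain
map (Rasmussen (2010), §4.1, eq. (4.1); Khovanov (2000), §6.3; Jacobsson (2004)), which is
constructed in the companion file `LinkKhSaddleChain`.

## What a saddle does to the cube

`L.saddle p q` has the same chords, signs, states and arcs as `L`, *definitionally*
(`state_saddle`, `arc_saddle`; `weight_saddle`, `edgeSign_saddle`, `homDegree_saddle`: the cube,
its gradings and its Koszul signs are literally shared). Only the successor changes, hence only the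
entering arcs at the two heads: `(L.saddle p q).arcIn (next p) = arcOut q`,
`(L.saddle p q).arcIn (next q) = arcOut p`, all other `arcIn r` unchanged (`arcIn_saddle_next_left`,
`arcIn_saddle_next_right`, `arcIn_saddle_of_ne`, `arcIn_saddle_ne_iff`). In a fixed state `σ` the
state graph of `L.saddle p q` is therefore obtained from that of `L` by an **edge trade** at the two
saddle arcs `a = arcOut p`, `b = arcOut q` (`stateGraph_saddle_adj_imp`,
`stateGraph_adj_imp_saddle`, through the description of state-graph edges as gluings of arc-ends,
`stateGraph_adj_iff_ends`),
so that the abstract edge-trade lemmas of `KhFlipReach` (`MergedReach`,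
`mergedReach_of_reachable_trade`, `reachable_trade_iff_mergedReach`) apply:

* `reachable_or_reachable_saddle`: **`a` and `b` lie on one circle before the saddle or after it**
  (for every, possibly virtual, diagram) — the parity count of `IsMergeAt.not_isSplitAt` run on
  arc-ends (`even_card_filter_ends`);
* the trichotomy `IsSaddleMerge` (`a`, `b` on different circles of `L`: then on one circle of
  `L.saddle p q`, `IsSaddleMerge.reachable_saddle`), `IsSaddleSplit` (different circles after: then
  one circle before), or neither (a one-to-one bifurcation, virtual diagrams / non-orientable bands
  only; excluded by `IsSaddleMerge.not_isSaddleSplit` from being both; see the `hopfLink` examples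
  of `LinkKhSaddleChain`), with `isSaddleSplit_iff_circleOf_eq` under merge-or-split;
* the circles: `IsSaddleMerge.reachable_saddle_iff` / `IsSaddleSplit.reachable_iff` (the two
  circles of `a`, `b` are united, all others unchanged), packaged as the abstract surgery relation
  of `KhFaces` — `IsSaddleMerge.surg : KhFace.Surg (L.circleOf σ) ((L.saddle p q).circleOf σ) a b`,
  `IsSaddleSplit.surg : KhFace.Surg ((L.saddle p q).circleOf σ) (L.circleOf σ) a b` — whence the
  circle counts `IsSaddleMerge.circleCount` (`- 1`), `IsSaddleSplit.circleCount` (`+ 1`) by the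
  abstract `KhFace.Surg.card_add_one`, the maps on circles `IsSaddleMerge.circleMap`,
  `IsSaddleSplit.circleMap` (onto), and the transfer lemmas `circleOf_saddle_eq_iff_of_ne`.

## The flip of one smoothing

The chain-map proof also needs the surgery description of the *chord flips* of `L` and of
`L.saddle p q`; this is taken from `LinkKhDSquared` (`IsMergeAt.surg`, `IsSplitAt.surg`, `kindAt`,
`edgeOK_kindAt`, `incidence_eq_edgeVal`, `ofLab`, `sum_ite_state_eq`), applied to both diagrams.

## Design note

Statements constantly mix `L` and `L.saddle p q` (same arcs and states); these are type-correct
by unfolding `saddle`, which `rw`/`simp` check at reducible transparency only, so `saddle` is made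
`[local reducible]` in this file (as `Functor.mapHomologicalComplex` is elsewhere in the library).
No named fact is introduced; everything is unconditional.

## References

* J. Rasmussen, *Khovanov homology and the slice genus*, Invent. Math. 182 (2010) 419–447, §4.1
  (elementary cobordisms; the saddle), eq. (4.1). [cite: Rasmussen2010, §4.1]
* M. Khovanov, *A categorification of the Jones polynomial*, Duke Math. J. 101 (2000) 359–426,
  §6 (surfaces and cube morphisms; §6.3 the saddle). [cite: Khovanov2000, §6]
* M. Jacobsson, *An invariant of link cobordisms from Khovanov homology*, Algebr. Geom. Topol. 4
  (2004) 1211–1251, §3 (the chain map of a saddle). [cite: Jacobsson2004, §3]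
* D. Bar-Natan, *Khovanov's homology for tangles and cobordisms*, Geom. Topol. 9 (2005), §8.
  [cite: BarNatan2005, §8]
* O. Viro, *Khovanov homology, its definitions and ramifications*, Fund. Math. 184 (2004), §5
  (one-to-one bifurcations in the virtual case). [cite: Viro2004, §5]
* D. Bar-Natan, *On Khovanov's categorification of the Jones polynomial*, Algebr. Geom. Topol. 2
  (2002), §3.1–3.2. [cite: BarNatan2002, §3.1]
-/

open Function Set

noncomputable section

namespace Literature.Topology.FourManifolds

/-! ## An abstract supplement to `KhFaces`: a surgery lowers the number of classes by one -/

namespace KhFace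

/-- **A surgery lowers the number of classes by one**: if `c'` is obtained from `c` by uniting the
two distinct classes of `α`, `β` (both maps onto their class types), then `#Y = #Y' + 1` — a merge
joins two circles into one, a split (read backwards) cuts one into two. Bar-Natan (2002), §3.1.
[cite: BarNatan2002, §3.1] -/
theorem Surg.card_add_one {X Y Y' : Type*} [Fintype Y] [Fintype Y'] {c : X → Y} {c' : X → Y'}
    {α β : X} (S : Surg c c' α β) (hc : Surjective c) (hc' : Surjective c') :
    Fintype.card Y' + 1 = Fintype.card Y := by
  classical
  -- the induced map on classes
  let φ : Y → Y' := fun y ↦ c' (Classical.choose (hc y))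
  have hφ : ∀ x, φ (c x) = c' x := fun x ↦ S.le (Classical.choose_spec (hc (c x)))
  have hcard : (Finset.univ.erase (c β)).card = (Finset.univ : Finset Y').card := by
    refine Finset.card_bij (fun y _ ↦ φ y) (fun _ _ ↦ Finset.mem_univ _) ?_ ?_
    · intro y₁ hy₁ y₂ hy₂ h12
      obtain ⟨x₁, rfl⟩ := hc y₁
      obtain ⟨x₂, rfl⟩ := hc y₂
      rw [Finset.mem_erase] at hy₁ hy₂
      rw [hφ, hφ] at h12
      rcases (S.rel x₁ x₂).1 h12 with h' | ⟨h₁', h₂'⟩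
      · exact h'
      · rw [h₁'.resolve_right hy₁.1, h₂'.resolve_right hy₂.1]
    · intro y' _
      obtain ⟨x, rfl⟩ := hc' y'
      by_cases hx : c x = c β
      · refine ⟨c α, Finset.mem_erase.2 ⟨S.ne, Finset.mem_univ _⟩, ?_⟩
        rw [hφ, S.eq]
        exact (S.le hx).symm
      · exact ⟨c x, Finset.mem_erase.2 ⟨hx, Finset.mem_univ _⟩, hφ x⟩
  rw [Finset.card_erase_of_mem (Finset.mem_univ _), Finset.card_univ, Finset.card_univ] at hcard
  have hpos : 0 < Fintype.card Y := Fintype.card_pos_iff.2 ⟨c α⟩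
  omega

end KhFace

namespace LinkGaussDiagram

-- `L.saddle p q` has the same chords, arcs and states as `L` *definitionally*; making `saddle`
-- reducible lets `rw`/`simp` work in statements mixing the two diagrams (their motives are
-- type-checked at reducible transparency).
set_option allowUnsafeReducibility true in
attribute [local reducible] LinkGaussDiagram.saddle

/-! ## The saddled diagram shares chords, states and arcs with the original one -/

section Basics

variable (L : LinkGaussDiagram) (p q : Fin (2 * L.n))

/-- **States are shared**: the states (and arcs) of `L.saddle p q` are those of `L`, as types,
definitionally (same chords; cf. `arc_saddle`). [folklore] -/
theorem state_saddle : (L.saddle p q).State = L.State := rfl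

/-- A saddle keeps the number of chords (definitionally). [folklore] -/
@[simp] theorem saddle_n : (L.saddle p q).n = L.n := rfl

/-- A saddle keeps the number of free circles (definitionally). [folklore] -/
@[simp] theorem saddle_free : (L.saddle p q).free = L.free := rfl

/-- A saddle keeps the over-passages (definitionally). [folklore] -/
@[simp] theorem saddle_overPos : (L.saddle p q).overPos = L.overPos := rfl

/-- A saddle keeps the under-passages (definitionally). [folklore] -/
@[simp] theorem saddle_underPos : (L.saddle p q).underPos = L.underPos := rfl

/-- A saddle keeps the signs (definitionally). [folklore] -/
@[simp] theorem saddle_sign : (L.saddle p q).sign = L.sign := rfl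

/-- The successor of the saddled diagram is `next * swap p q`. Rasmussen (2010), §4.1.
[cite: Rasmussen2010, §4.1] -/
theorem saddle_next : (L.saddle p q).next = L.next * Equiv.swap p q := rfl

/-- A saddle keeps the chord through each marked point (definitionally). [folklore] -/
@[simp] theorem chordOf_saddle (r : Fin (2 * L.n)) : (L.saddle p q).chordOf r = L.chordOf r :=
  rfl

/-- A saddle keeps partners (definitionally). [folklore] -/
@[simp] theorem partner_saddle (r : Fin (2 * L.n)) : (L.saddle p q).partner r = L.partner r :=
  rfl

/-- A saddle keeps the Seifert rule (same chords, same signs, same states). [folklore] -/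
@[simp] theorem isSeifert_saddle (σ : L.State) (i : Fin L.n) :
    (L.saddle p q).isSeifert σ i = L.isSeifert σ i := rfl

/-- A saddle keeps `n₊` (definitionally). [folklore] -/
@[simp] theorem nPlus_saddle : (L.saddle p q).nPlus = L.nPlus := rfl

/-- A saddle keeps `n₋` (definitionally). [folklore] -/
@[simp] theorem nMinus_saddle : (L.saddle p q).nMinus = L.nMinus := rfl

/-- A saddle keeps the arc leaving each marked point (definitionally; `(L.saddle p q).Arc = L.Arc`,
`arc_saddle`). [folklore] -/
@[simp] theorem arcOut_saddle (r : Fin (2 * L.n)) : (L.saddle p q).arcOut r = L.arcOut r := rfl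

/-- **The arc entering `r` after the saddle** leaves `swap p q (next⁻¹ r)`: the saddle re-glues
the heads of the two saddle arcs and nothing else. Rasmussen (2010), §4.1.
[cite: Rasmussen2010, §4.1] -/
theorem arcIn_saddle (r : Fin (2 * L.n)) :
    (L.saddle p q).arcIn r = L.arcOut (Equiv.swap p q (L.next.symm r)) := rfl

/-- After the saddle the arc entering `next p` is the arc leaving `q`. [folklore] -/
@[simp] theorem arcIn_saddle_next_left : (L.saddle p q).arcIn (L.next p) = L.arcOut q := by
  rw [arcIn_saddle, Equiv.symm_apply_apply, Equiv.swap_apply_left]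

/-- After the saddle the arc entering `next q` is the arc leaving `p`. [folklore] -/
@[simp] theorem arcIn_saddle_next_right : (L.saddle p q).arcIn (L.next q) = L.arcOut p := by
  rw [arcIn_saddle, Equiv.symm_apply_apply, Equiv.swap_apply_right]

/-- The saddle changes no other entering arc: `(L.saddle p q).arcIn r = L.arcIn r` for
`r ∉ {next p, next q}`. [folklore] -/
theorem arcIn_saddle_of_ne {r : Fin (2 * L.n)} (hp : r ≠ L.next p) (hq : r ≠ L.next q) :
    (L.saddle p q).arcIn r = L.arcIn r := by
  rw [arcIn_saddle, Equiv.swap_apply_of_ne_of_ne, arcOut_next_symm]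
  · intro h; exact hp (by rw [← h, Equiv.apply_symm_apply])
  · intro h; exact hq (by rw [← h, Equiv.apply_symm_apply])

/-- **Exactly two entering arcs change**: for `p ≠ q`, `(L.saddle p q).arcIn r ≠ L.arcIn r` iff
`r` is the head `next p` or `next q` of a saddle arc. [folklore] -/
theorem arcIn_saddle_ne_iff (hpq : p ≠ q) (r : Fin (2 * L.n)) :
    (L.saddle p q).arcIn r ≠ L.arcIn r ↔ r = L.next p ∨ r = L.next q := by
  constructor
  · intro h
    by_contra hr
    rw [not_or] at hr
    exact h (L.arcIn_saddle_of_ne p q hr.1 hr.2)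
  · rintro (rfl | rfl)
    · rw [arcIn_saddle_next_left, arcIn_next]
      exact fun h ↦ hpq (L.arcOut_injective h).symm
    · rw [arcIn_saddle_next_right, arcIn_next]
      exact fun h ↦ hpq (L.arcOut_injective h)

/-- A saddle keeps the gluing of arc-ends (same chords, partners, Seifert rule). [folklore] -/
@[simp] theorem endGlue_saddle (σ : L.State) (e : Fin (2 * L.n) × Bool) :
    (L.saddle p q).endGlue σ e = L.endGlue σ e := rfl

/-- Homological degrees of enhanced states of the saddled diagram are computed by the same formula
`|s| - n₋` (same chords and signs). Bar-Natan (2002), §3.2. [cite: BarNatan2002, §3.2] -/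
theorem homDegree_saddle (s : (L.saddle p q).EnhancedState) :
    homDegree s = (s.state.weight : ℤ) - L.nMinus := rfl

end Basics

section Basics2

variable (L : LinkGaussDiagram) (p q : Fin (2 * L.n))

/-- The weight of a state is the same for `L` and `L.saddle p q` (same chords). [folklore] -/
theorem weight_saddle (σ : L.State) :
    State.weight (L := L.saddle p q) σ = State.weight (L := L) σ := rfl

/-- The Koszul signs of the cube are the same for `L` and `L.saddle p q` (same chords, same
states): the saddle map needs no sign correction. Khovanov (2000), §6; Bar-Natan (2005), §8.
[cite: Khovanov2000, §6] -/
theorem edgeSign_saddle (σ : L.State) (i : Fin L.n) :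
    edgeSign (L := L.saddle p q) σ i = edgeSign (L := L) σ i := rfl

end Basics2

/-! ## Circles and reachability -/

section Circles

variable (L : LinkGaussDiagram)

variable {L} in
/-- Two arcs lie on the same state circle iff they are connected in the state graph. [folklore] -/
theorem circleOf_eq_iff_reachable {σ : L.State} {x y : L.Arc} :
    L.circleOf σ x = L.circleOf σ y ↔ (L.stateGraph σ).Reachable x y :=
  SimpleGraph.ConnectedComponent.eq

/-- `circleOf σ` is onto: every state circle passes through some arc. [folklore] -/
theorem circleOf_surjective (σ : L.State) : Surjective (L.circleOf σ) :=
  fun c ↦ c.ind (fun a ↦ ⟨a, rfl⟩)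

/-- `MergedReach` (`KhFlipReach`) in the form of the abstract surgery relation of `KhFaces`.
[folklore] -/
theorem mergedReach_iff_surgRel {V : Type*} {Γ : SimpleGraph V} {a b u v : V} :
    MergedReach Γ a b u v ↔ Γ.Reachable u v ∨
      ((Γ.Reachable u a ∨ Γ.Reachable u b) ∧ (Γ.Reachable v a ∨ Γ.Reachable v b)) := by
  unfold MergedReach
  constructor
  · rintro (huv | ⟨hua, hbv⟩ | ⟨hub, hav⟩)
    · exact Or.inl huv
    · exact Or.inr ⟨Or.inl hua, Or.inr hbv.symm⟩
    · exact Or.inr ⟨Or.inr hub, Or.inl hav.symm⟩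
  · rintro (huv | ⟨hua | hub, hva | hvb⟩)
    · exact Or.inl huv
    · exact Or.inl (hua.trans hva.symm)
    · exact Or.inr (Or.inl ⟨hua, hvb.symm⟩)
    · exact Or.inr (Or.inr ⟨hub, hva.symm⟩)
    · exact Or.inl (hub.trans hvb.symm)

end Circles

/-! ## State graphs in terms of arc-ends -/

section Ends

variable (L : LinkGaussDiagram)

/-- **Edges of the state graph are gluings of arc-ends**: two distinct arcs are adjacent in the
state graph of `σ` iff some end `e` of the first is glued by `σ` to an end of the second
(`endArc`, `endGlue` of `LinkKhResolutions`). Viro (2004), §2. [cite: Viro2004, §2] -/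
theorem stateGraph_adj_iff_ends (σ : L.State) (u v : L.Arc) :
    (L.stateGraph σ).Adj u v ↔ u ≠ v ∧ ∃ e, L.endArc e = u ∧ L.endArc (L.endGlue σ e) = v := by
  rw [stateGraph, SimpleGraph.fromRel_adj]
  refine and_congr_right fun hne ↦ ⟨?_, ?_⟩
  · -- a gluing clause at `r` is the gluing of an end at `r` or at `partner r`
    have key : ∀ u v, L.stateAdj σ u v →
        ∃ e, L.endArc e = u ∧ L.endArc (L.endGlue σ e) = v := by
      rintro u v ⟨-, r, ⟨hs, ⟨rfl, rfl⟩ | ⟨rfl, rfl⟩⟩ | ⟨hs, ⟨rfl, rfl⟩ | ⟨rfl, rfl⟩⟩⟩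
      · exact ⟨(r, false), rfl, by simp [endArc, endGlue, hs]⟩
      · exact ⟨(L.partner r, true), rfl, by simp [endArc, endGlue, hs]⟩
      · exact ⟨(r, false), rfl, by simp [endArc, endGlue, hs]⟩
      · exact ⟨(r, true), rfl, by simp [endArc, endGlue, hs]⟩
    rintro (h | h)
    · exact key u v h
    · obtain ⟨e, he, he'⟩ := key v u h
      exact ⟨L.endGlue σ e, he', by rw [endGlue_endGlue]; exact he⟩
  · rintro ⟨⟨r, b⟩, rfl, rfl⟩
    refine Or.inl ⟨hne, ?_⟩
    cases hs : L.isSeifert σ (L.chordOf r) <;> cases b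
    · exact ⟨r, Or.inr ⟨hs, Or.inl ⟨rfl, by simp [endArc, endGlue, hs]⟩⟩⟩
    · exact ⟨r, Or.inr ⟨hs, Or.inr ⟨rfl, by simp [endArc, endGlue, hs]⟩⟩⟩
    · exact ⟨r, Or.inl ⟨hs, Or.inl ⟨rfl, by simp [endArc, endGlue, hs]⟩⟩⟩
    · refine ⟨L.partner r, Or.inl ⟨by simpa using hs, Or.inr ⟨?_, ?_⟩⟩⟩ <;>
        simp [endArc, endGlue, hs]

/-- **Parity count (general form).** Let `S` be a set of arc-ends closed under the gluing of `σ`,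
and `K` a set of arcs closed under the gluings of `σ` at all ends outside `S`. Then `K` carries
an even number of the ends in `S` (every arc has two ends; the ends of `K` outside `S` are matched
in pairs by the gluing). Uses `GaussDiagram.even_card_of_involutive`. [folklore] -/
theorem even_card_filter_ends (σ : L.State) (K : Set L.Arc) [DecidablePred (· ∈ K)]
    (S : Finset (Fin (2 * L.n) × Bool)) (hS : ∀ e ∈ S, L.endGlue σ e ∈ S)
    (hK : ∀ e, e ∉ S → L.endArc e ∈ K → L.endArc (L.endGlue σ e) ∈ K) :
    Even (S.filter fun e ↦ L.endArc e ∈ K).card := by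
  classical
  set T : Finset (Fin (2 * L.n) × Bool) := Finset.univ.filter fun e ↦ L.endArc e ∈ K with hT
  have hTS : (S.filter fun e ↦ L.endArc e ∈ K) = T ∩ S := by
    ext e
    simp only [hT, Finset.mem_filter, Finset.mem_inter, Finset.mem_univ, true_and, and_comm]
  rw [hTS]
  have h₁ : Even T.card := by
    refine GaussDiagram.even_card_of_involutive T L.endFlip (fun e he ↦ ?_)
      (fun e _ ↦ L.endFlip_endFlip e) (fun e _ ↦ L.endFlip_ne e)
    simpa [hT] using he
  have h₂ : Even (T \ S).card := by
    refine GaussDiagram.even_card_of_involutive (T \ S) (L.endGlue σ) (fun e he ↦ ?_)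
      (fun e _ ↦ L.endGlue_endGlue σ e) (fun e _ ↦ L.endGlue_ne σ e)
    simp only [Finset.mem_sdiff, hT, Finset.mem_filter, Finset.mem_univ, true_and] at he ⊢
    refine ⟨hK e he.2 he.1, fun h ↦ he.2 ?_⟩
    have := hS _ h
    rwa [endGlue_endGlue] at this
  have h₃ := Finset.card_sdiff_add_card_inter T S
  rw [← h₃] at h₁
  exact (Nat.even_add.mp h₁).mp h₂

end Ends

/-! ## The state circles of a saddle: edge trade, merge or split -/

section SaddleCircles

variable (L : LinkGaussDiagram) (p q : Fin (2 * L.n))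

/-- The saddled diagram has the same arc-ends; only the arcs of the in-ends at `next p`, `next q`
change. [folklore] -/
theorem endArc_saddle_of_ne {e : Fin (2 * L.n) × Bool} (h₁ : e ≠ (L.next p, false))
    (h₂ : e ≠ (L.next q, false)) : (L.saddle p q).endArc e = L.endArc e := by
  obtain ⟨r, _ | _⟩ := e
  · change (L.saddle p q).arcIn r = L.arcIn r
    refine L.arcIn_saddle_of_ne p q ?_ ?_
    · rintro rfl; exact h₁ rfl
    · rintro rfl; exact h₂ rfl
  · rfl

/-- After the saddle the in-end at `next p` belongs to the arc leaving `q`. [folklore] -/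
theorem endArc_saddle_left : (L.saddle p q).endArc (L.next p, false) = L.arcOut q :=
  L.arcIn_saddle_next_left p q

/-- After the saddle the in-end at `next q` belongs to the arc leaving `p`. [folklore] -/
theorem endArc_saddle_right : (L.saddle p q).endArc (L.next q, false) = L.arcOut p :=
  L.arcIn_saddle_next_right p q

/-- Before the saddle the in-end at `next p` belongs to the arc leaving `p`. [folklore] -/
theorem endArc_next_left : L.endArc (L.next p, false) = L.arcOut p := L.arcIn_next p

/-- Before the saddle the in-end at `next q` belongs to the arc leaving `q`. [folklore] -/
theorem endArc_next_right : L.endArc (L.next q, false) = L.arcOut q := L.arcIn_next q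

/-- The **far end** of the saddle arc leaving `p` in the state `σ`: the arc glued by `σ` to the
head (at `next p`) of the arc leaving `p`. [folklore] -/
def saddleFar (σ : L.State) (p : Fin (2 * L.n)) : L.Arc :=
  L.endArc (L.endGlue σ (L.next p, false))

/-- The saddle arc leaving `p` is connected to its far end before the saddle. [folklore] -/
theorem reachable_arcOut_saddleFar (σ : L.State) (p : Fin (2 * L.n)) :
    (L.stateGraph σ).Reachable (L.arcOut p) (L.saddleFar σ p) := by
  have := L.reachable_endArc_endGlue σ (L.next p, false)
  rwa [endArc_next_left] at this

variable {p q}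

/-- After the saddle, the arc leaving `q` is connected to the old far end of the arc leaving `p`
(the in-end at `next p` now belongs to the arc leaving `q`). [folklore] -/
theorem reachable_saddle_arcOut_saddleFar (σ : L.State) :
    ((L.saddle p q).stateGraph σ).Reachable (L.arcOut q) (L.saddleFar σ p) := by
  have h := (L.saddle p q).reachable_endArc_endGlue σ (L.next p, false)
  rw [endArc_saddle_left, endGlue_saddle] at h
  by_cases h₂ : L.endGlue σ (L.next p, false) = (L.next q, false)
  · -- degenerate gluing: the far end of `arcOut p` is `arcOut q` itself
    have : L.saddleFar σ p = L.arcOut q := by rw [saddleFar, h₂, endArc_next_right]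
    rw [this]
  · have h₁ : L.endGlue σ (L.next p, false) ≠ (L.next p, false) := L.endGlue_ne σ _
    rwa [L.endArc_saddle_of_ne p q h₁ h₂] at h

/-- After the saddle, the arc leaving `p` is connected to the old far end of the arc leaving `q`.
[folklore] -/
theorem reachable_saddle_arcOut_saddleFar' (σ : L.State) :
    ((L.saddle p q).stateGraph σ).Reachable (L.arcOut p) (L.saddleFar σ q) := by
  have h := (L.saddle p q).reachable_endArc_endGlue σ (L.next q, false)
  rw [endArc_saddle_right, endGlue_saddle] at h
  by_cases h₁ : L.endGlue σ (L.next q, false) = (L.next p, false)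
  · have : L.saddleFar σ q = L.arcOut p := by rw [saddleFar, h₁, endArc_next_left]
    rw [this]
  · have h₂ : L.endGlue σ (L.next q, false) ≠ (L.next q, false) := L.endGlue_ne σ _
    rwa [L.endArc_saddle_of_ne p q h₁ h₂] at h

/-- **Edge trade of a saddle, first half**: every edge of the state graph of `L.saddle p q` is an
edge of the state graph of `L` (same state) or one of the two new gluings
`{arcOut p, far end of arcOut q}`, `{arcOut q, far end of arcOut p}`. [folklore] -/
theorem stateGraph_saddle_adj_imp (hpq : p ≠ q) (σ : L.State) (u v : L.Arc)
    (h : ((L.saddle p q).stateGraph σ).Adj u v) :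
    (L.stateGraph σ).Adj u v ∨ s(u, v) = s(L.arcOut p, L.saddleFar σ q) ∨
      s(u, v) = s(L.arcOut q, L.saddleFar σ p) := by
  have hnpq : L.next p ≠ L.next q := fun h' ↦ hpq (L.next.injective h')
  rw [stateGraph_adj_iff_ends] at h
  obtain ⟨hne, e, rfl, rfl⟩ := h
  simp only [endGlue_saddle] at hne ⊢
  rw [L.stateGraph_adj_iff_ends]
  set g := L.endGlue σ with hg
  have hgg : ∀ e, g (g e) = e := L.endGlue_endGlue σ
  by_cases he₁ : e = (L.next p, false)
  · subst he₁
    rw [endArc_saddle_left] at hne ⊢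
    by_cases hge : g (L.next p, false) = (L.next q, false)
    · rw [hge, endArc_saddle_right] at hne ⊢
      refine Or.inl ⟨hne, (L.next q, false), L.endArc_next_right q, ?_⟩
      rw [← hge, hgg, endArc_next_left]
    · rw [L.endArc_saddle_of_ne p q (L.endGlue_ne σ _) hge]
      exact Or.inr (Or.inr rfl)
  by_cases he₂ : e = (L.next q, false)
  · subst he₂
    rw [endArc_saddle_right] at hne ⊢
    by_cases hge : g (L.next q, false) = (L.next p, false)
    · rw [hge, endArc_saddle_left] at hne ⊢
      refine Or.inl ⟨hne, (L.next p, false), L.endArc_next_left p, ?_⟩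
      rw [← hge, hgg, endArc_next_right]
    · rw [L.endArc_saddle_of_ne p q hge (L.endGlue_ne σ _)]
      exact Or.inr (Or.inl rfl)
  rw [L.endArc_saddle_of_ne p q he₁ he₂] at hne ⊢
  by_cases hg₁ : g e = (L.next p, false)
  · rw [hg₁, endArc_saddle_left]
    have : e = g (L.next p, false) := by rw [← hg₁, hgg]
    rw [this]
    exact Or.inr (Or.inr Sym2.eq_swap)
  by_cases hg₂ : g e = (L.next q, false)
  · rw [hg₂, endArc_saddle_right]
    have : e = g (L.next q, false) := by rw [← hg₂, hgg]
    rw [this]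
    exact Or.inr (Or.inl Sym2.eq_swap)
  rw [L.endArc_saddle_of_ne p q hg₁ hg₂] at hne ⊢
  exact Or.inl ⟨hne, e, rfl, rfl⟩

/-- **Edge trade of a saddle, second half**: every edge of the state graph of `L` is an edge of
the state graph of `L.saddle p q` or one of the two old gluings `{arcOut p, its far end}`,
`{arcOut q, its far end}`. [folklore] -/
theorem stateGraph_adj_imp_saddle (σ : L.State) (u v : L.Arc) (h : (L.stateGraph σ).Adj u v) :
    ((L.saddle p q).stateGraph σ).Adj u v ∨ s(u, v) = s(L.arcOut p, L.saddleFar σ p) ∨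
      s(u, v) = s(L.arcOut q, L.saddleFar σ q) := by
  rw [stateGraph_adj_iff_ends] at h
  obtain ⟨hne, e, rfl, rfl⟩ := h
  rw [(L.saddle p q).stateGraph_adj_iff_ends]
  simp only [endGlue_saddle]
  set g := L.endGlue σ with hg
  have hgg : ∀ e, g (g e) = e := L.endGlue_endGlue σ
  by_cases he₁ : e = (L.next p, false)
  · subst he₁; rw [endArc_next_left]; exact Or.inr (Or.inl rfl)
  by_cases he₂ : e = (L.next q, false)
  · subst he₂; rw [endArc_next_right]; exact Or.inr (Or.inr rfl)
  by_cases hg₁ : g e = (L.next p, false)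
  · have : e = g (L.next p, false) := by rw [← hg₁, hgg]
    rw [hg₁, endArc_next_left, this]
    exact Or.inr (Or.inl Sym2.eq_swap)
  by_cases hg₂ : g e = (L.next q, false)
  · have : e = g (L.next q, false) := by rw [← hg₂, hgg]
    rw [hg₂, endArc_next_right, this]
    exact Or.inr (Or.inr Sym2.eq_swap)
  refine Or.inl ⟨hne, e, L.endArc_saddle_of_ne p q he₁ he₂, L.endArc_saddle_of_ne p q hg₁ hg₂⟩

/-- **Circles after a saddle refine merged circles before it**: two arcs on a common circle of
`L.saddle p q` lie on a common circle of `L` (same state), or one lies on the circle of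
`arcOut p` and the other on the circle of `arcOut q`. Rasmussen (2010), §4.1 (a saddle is a
single Morse modification). [cite: Rasmussen2010, §4.1] -/
theorem mergedReach_of_reachable_saddle (hpq : p ≠ q) (σ : L.State) {u v : L.Arc}
    (h : ((L.saddle p q).stateGraph σ).Reachable u v) :
    MergedReach (L.stateGraph σ) (L.arcOut p) (L.arcOut q) u v :=
  mergedReach_of_reachable_trade (L.stateGraph_saddle_adj_imp hpq σ)
    (L.reachable_arcOut_saddleFar σ p) (L.reachable_arcOut_saddleFar σ q) h

/-- **Circles before a saddle refine merged circles after it.** [cite: Rasmussen2010, §4.1] -/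
theorem mergedReach_saddle_of_reachable (σ : L.State) {u v : L.Arc}
    (h : (L.stateGraph σ).Reachable u v) :
    MergedReach ((L.saddle p q).stateGraph σ) (L.arcOut p) (L.arcOut q) u v :=
  mergedReach_of_reachable_trade (L.stateGraph_adj_imp_saddle σ)
    (L.reachable_saddle_arcOut_saddleFar' σ) (L.reachable_saddle_arcOut_saddleFar σ) h

end SaddleCircles

/-! ## Merge or split -/

section MergeOrSplit

variable (L : LinkGaussDiagram) {p q : Fin (2 * L.n)}

/-- **A saddle is undone by a merge on one side** (for every, possibly virtual, link Gauss
diagram): the two saddle arcs `arcOut p`, `arcOut q` lie on a common state circle of `σ` before the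
saddle or after it — surgery of a closed 1-manifold along a band joining two distinct components
yields one component. Parity count of the arc-ends at the two re-glued heads on the set of arcs
reachable from `arcOut p` both before and after (`even_card_filter_ends`), as in
`IsMergeAt.not_isSplitAt`. Rasmussen (2010), §4.1; Viro (2004), §5.2. [cite: Rasmussen2010, §4.1] -/
theorem reachable_or_reachable_saddle (σ : L.State) (p q : Fin (2 * L.n)) :
    (L.stateGraph σ).Reachable (L.arcOut p) (L.arcOut q) ∨
      ((L.saddle p q).stateGraph σ).Reachable (L.arcOut p) (L.arcOut q) := by
  classical
  by_cases hpq : p = q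
  · subst hpq; exact Or.inl (SimpleGraph.Reachable.refl _)
  by_contra hcon
  rw [not_or] at hcon
  obtain ⟨HM, HS⟩ := hcon
  set Γ := L.stateGraph σ
  set Γ' : SimpleGraph L.Arc := (L.saddle p q).stateGraph σ
  set g := L.endGlue σ with hg
  have hgg : ∀ e, g (g e) = e := L.endGlue_endGlue σ
  set e₁ : Fin (2 * L.n) × Bool := (L.next p, false)
  set e₂ : Fin (2 * L.n) × Bool := (L.next q, false)
  have h12 : e₁ ≠ e₂ := fun h ↦ hpq (L.next.injective (congrArg Prod.fst h))
  -- the arcs reachable from `a = arcOut p` both before and after the saddle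
  set K : Set L.Arc := {c | Γ.Reachable (L.arcOut p) c ∧ Γ'.Reachable (L.arcOut p) c} with hK
  set S : Finset (Fin (2 * L.n) × Bool) := {e₁, e₂, g e₁, g e₂} with hSdef
  have hS : ∀ e ∈ S, g e ∈ S := by
    intro e he
    simp only [hSdef, Finset.mem_insert, Finset.mem_singleton] at he ⊢
    rcases he with rfl | rfl | rfl | rfl
    · exact Or.inr (Or.inr (Or.inl rfl))
    · exact Or.inr (Or.inr (Or.inr rfl))
    · exact Or.inl (hgg _)
    · exact Or.inr (Or.inl (hgg _))
  have hKcl : ∀ e, e ∉ S → L.endArc e ∈ K → L.endArc (g e) ∈ K := by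
    intro e he ⟨hr, hr'⟩
    simp only [hSdef, Finset.mem_insert, Finset.mem_singleton, not_or] at he
    obtain ⟨he1, he2, he3, he4⟩ := he
    have hg1 : g e ≠ e₁ := fun h ↦ he3 (by rw [← h, hgg])
    have hg2 : g e ≠ e₂ := fun h ↦ he4 (by rw [← h, hgg])
    refine ⟨hr.trans (L.reachable_endArc_endGlue σ e), hr'.trans ?_⟩
    have := (L.saddle p q).reachable_endArc_endGlue σ e
    rwa [endGlue_saddle, L.endArc_saddle_of_ne p q he1 he2,
      L.endArc_saddle_of_ne p q hg1 hg2] at this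
  have hev := L.even_card_filter_ends σ K S hS hKcl
  have ha : L.endArc e₁ ∈ K := by
    rw [endArc_next_left]; exact ⟨SimpleGraph.Reachable.refl _, SimpleGraph.Reachable.refl _⟩
  -- hence another end of `S` lies on `K`
  obtain ⟨e', he'S, he'K, hne⟩ : ∃ e' ∈ S, L.endArc e' ∈ K ∧ e' ≠ e₁ := by
    by_contra hcon
    push Not at hcon
    have : (S.filter fun e ↦ L.endArc e ∈ K) = {e₁} := by
      ext e
      simp only [Finset.mem_filter, Finset.mem_singleton]
      constructor
      · rintro ⟨heS, heK⟩; exact hcon e heS heK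
      · rintro rfl; exact ⟨by simp [hSdef], ha⟩
    rw [this, Finset.card_singleton] at hev
    exact Nat.not_even_one hev
  simp only [hSdef, Finset.mem_insert, Finset.mem_singleton] at he'S
  rcases he'S with rfl | rfl | rfl | rfl
  · exact hne rfl
  · -- `b = arcOut q` reachable from `a` before the saddle
    rw [endArc_next_right] at he'K
    exact HM he'K.1
  · -- the end glued to the head of `a`: its arc reaches `b` after the saddle
    by_cases hge : g e₁ = e₂
    · rw [hge, endArc_next_right] at he'K
      exact HM he'K.1
    · have h1 : g e₁ ≠ e₁ := L.endGlue_ne σ _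
      have := (L.saddle p q).reachable_endArc_endGlue σ e₁
      rw [endGlue_saddle, endArc_saddle_left, L.endArc_saddle_of_ne p q h1 hge] at this
      exact HS (he'K.2.trans this.symm)
  · -- the end glued to the head of `b`: its arc reaches `b` before the saddle
    have := L.reachable_endArc_endGlue σ e₂
    rw [endArc_next_right] at this
    exact HM (he'K.1.trans this.symm)

variable (p q)

/-- The saddle at `(p, q)` is a **merge** in the state `σ`: before the saddle the two saddle arcs
`arcOut p`, `arcOut q` lie on different state circles (for virtual diagrams a saddle may be
neither a merge nor a split — a one-to-one bifurcation, as for flips, Viro (2004), §5 — but never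
both, `IsSaddleMerge.not_isSaddleSplit`). Rasmussen (2010), §4.1. [cite: Rasmussen2010, §4.1] -/
def IsSaddleMerge (σ : L.State) : Prop :=
  L.circleOf σ (L.arcOut p) ≠ L.circleOf σ (L.arcOut q)

/-- The saddle at `(p, q)` is a **split** in the state `σ`: after the saddle the two saddle arcs
lie on different state circles of `L.saddle p q`. Rasmussen (2010), §4.1.
[cite: Rasmussen2010, §4.1] -/
def IsSaddleSplit (σ : L.State) : Prop :=
  (L.saddle p q).circleOf σ (L.arcOut p) ≠ (L.saddle p q).circleOf σ (L.arcOut q)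

/-- Being a saddle-merge is decidable. [folklore] -/
instance (σ : L.State) : Decidable (L.IsSaddleMerge p q σ) := by
  unfold IsSaddleMerge; infer_instance

/-- Being a saddle-split is decidable. [folklore] -/
instance (σ : L.State) : Decidable (L.IsSaddleSplit p q σ) := by
  unfold IsSaddleSplit; infer_instance

/-- Read backwards, the saddle of `L.saddle p q` at `(p, q)` is `L` (`saddle_saddle`); a
saddle-split of `L` is a saddle-merge of `L.saddle p q` (definitionally, states being shared).
[folklore] -/
theorem isSaddleMerge_saddle_iff (σ : L.State) :
    (L.saddle p q).IsSaddleMerge p q σ ↔ L.IsSaddleSplit p q σ := Iff.rfl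

variable {L p q}

/-- **A saddle-merge is not a saddle-split** (for every, possibly virtual, link diagram).
Rasmussen (2010), §4.1. [cite: Rasmussen2010, §4.1] -/
theorem IsSaddleMerge.not_isSaddleSplit {σ : L.State} (h : L.IsSaddleMerge p q σ) :
    ¬ L.IsSaddleSplit p q σ := by
  intro h'
  unfold IsSaddleMerge at h
  unfold IsSaddleSplit at h'
  rw [Ne, circleOf_eq_iff_reachable] at h h'
  exact (L.reachable_or_reachable_saddle σ p q).elim h h'

/-- After a saddle-merge the two saddle arcs lie on one circle. [folklore] -/
theorem IsSaddleMerge.reachable_saddle {σ : L.State} (h : L.IsSaddleMerge p q σ) :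
    ((L.saddle p q).stateGraph σ).Reachable (L.arcOut p) (L.arcOut q) := by
  unfold IsSaddleMerge at h
  rw [Ne, circleOf_eq_iff_reachable] at h
  exact (L.reachable_or_reachable_saddle σ p q).resolve_left h

/-- Before a saddle-split the two saddle arcs lie on one circle. [folklore] -/
theorem IsSaddleSplit.reachable {σ : L.State} (h : L.IsSaddleSplit p q σ) :
    (L.stateGraph σ).Reachable (L.arcOut p) (L.arcOut q) := by
  unfold IsSaddleSplit at h
  rw [Ne, circleOf_eq_iff_reachable] at h
  exact (L.reachable_or_reachable_saddle σ p q).resolve_right h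

/-- A saddle-merge is between distinct arcs. [folklore] -/
theorem IsSaddleMerge.ne {σ : L.State} (h : L.IsSaddleMerge p q σ) : p ≠ q := by
  rintro rfl; exact h rfl

/-- A saddle-split is between distinct arcs. [folklore] -/
theorem IsSaddleSplit.ne {σ : L.State} (h : L.IsSaddleSplit p q σ) : p ≠ q := by
  rintro rfl; exact h rfl

/-- **The dichotomy for an admissible saddle.** If the saddle is a merge or a split in `σ` (no
one-to-one bifurcation — the realisability input), then it is a split iff the two saddle arcs lie
on one circle of `σ`, and a merge iff they do not (by definition). Rasmussen (2010), §4.1.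
[cite: Rasmussen2010, §4.1] -/
theorem isSaddleSplit_iff_circleOf_eq {σ : L.State}
    (hsad : L.IsSaddleMerge p q σ ∨ L.IsSaddleSplit p q σ) :
    L.IsSaddleSplit p q σ ↔ L.circleOf σ (L.arcOut p) = L.circleOf σ (L.arcOut q) := by
  constructor
  · exact fun h ↦ circleOf_eq_iff_reachable.2 h.reachable
  · intro h
    exact hsad.resolve_left (fun hm ↦ hm h)

/-- **Circles after a saddle-merge**: two arcs lie on a common circle of `L.saddle p q` iff they
lie on a common circle of `L`, or one lies on the circle of `arcOut p` and the other on the circle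
of `arcOut q` (the two circles are united, all others unchanged). Rasmussen (2010), §4.1.
[cite: Rasmussen2010, §4.1] -/
theorem IsSaddleMerge.reachable_saddle_iff {σ : L.State} (h : L.IsSaddleMerge p q σ)
    (u v : L.Arc) :
    ((L.saddle p q).stateGraph σ).Reachable u v ↔
      MergedReach (L.stateGraph σ) (L.arcOut p) (L.arcOut q) u v :=
  reachable_trade_iff_mergedReach (L.stateGraph_saddle_adj_imp h.ne σ)
    (L.stateGraph_adj_imp_saddle σ) (L.reachable_arcOut_saddleFar σ p)
    (L.reachable_arcOut_saddleFar σ q) (L.reachable_saddle_arcOut_saddleFar' σ)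
    (L.reachable_saddle_arcOut_saddleFar σ) h.reachable_saddle

/-- **Circles before a saddle-split**: the split circle of `L` is the union of the two new
circles of `L.saddle p q` through the saddle arcs, all others unchanged. Rasmussen (2010), §4.1.
[cite: Rasmussen2010, §4.1] -/
theorem IsSaddleSplit.reachable_iff {σ : L.State} (h : L.IsSaddleSplit p q σ) (u v : L.Arc) :
    (L.stateGraph σ).Reachable u v ↔
      MergedReach ((L.saddle p q).stateGraph σ) (L.arcOut p) (L.arcOut q) u v :=
  reachable_trade_iff_mergedReach (L.stateGraph_adj_imp_saddle σ)
    (L.stateGraph_saddle_adj_imp h.ne σ) (L.reachable_saddle_arcOut_saddleFar' σ)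
    (L.reachable_saddle_arcOut_saddleFar σ) (L.reachable_arcOut_saddleFar σ p)
    (L.reachable_arcOut_saddleFar σ q) h.reachable

/-- The circles of a saddle-merge as the abstract surgery relation of `KhFaces`: the circle map of
`L.saddle p q` is that of `L` with the classes of the two saddle arcs united.
Rasmussen (2010), §4.1; Khovanov (2000), §6. [cite: Rasmussen2010, §4.1] -/
theorem IsSaddleMerge.surg {σ : L.State} (h : L.IsSaddleMerge p q σ) :
    KhFace.Surg (L.circleOf σ) ((L.saddle p q).circleOf σ) (L.arcOut p) (L.arcOut q) where
  ne := h
  rel x y := by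
    rw [(L.saddle p q).circleOf_eq_iff_reachable, h.reachable_saddle_iff, mergedReach_iff_surgRel]
    simp only [circleOf_eq_iff_reachable]

/-- The circles of a saddle-split as the abstract surgery relation of `KhFaces` (read backwards:
the circle map of `L` is that of `L.saddle p q` with the two new classes united).
Rasmussen (2010), §4.1; Khovanov (2000), §6. [cite: Rasmussen2010, §4.1] -/
theorem IsSaddleSplit.surg {σ : L.State} (h : L.IsSaddleSplit p q σ) :
    KhFace.Surg ((L.saddle p q).circleOf σ) (L.circleOf σ) (L.arcOut p) (L.arcOut q) where
  ne := h
  rel x y := by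
    rw [L.circleOf_eq_iff_reachable, h.reachable_iff, mergedReach_iff_surgRel]
    simp only [circleOf_eq_iff_reachable]

/-- Off the two merged circles a saddle-merge does not change the circles. [folklore] -/
theorem IsSaddleMerge.circleOf_saddle_eq_iff_of_ne {σ : L.State} (h : L.IsSaddleMerge p q σ)
    (x : L.Arc) {y : L.Arc} (hp : L.circleOf σ y ≠ L.circleOf σ (L.arcOut p))
    (hq : L.circleOf σ y ≠ L.circleOf σ (L.arcOut q)) :
    (L.saddle p q).circleOf σ x = (L.saddle p q).circleOf σ y ↔
      L.circleOf σ x = L.circleOf σ y :=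
  h.surg.eq_iff_of_ne x hp hq

/-- Off the split circle a saddle-split does not change the circles. [folklore] -/
theorem IsSaddleSplit.circleOf_saddle_eq_iff_of_ne {σ : L.State} (h : L.IsSaddleSplit p q σ)
    {x : L.Arc} (hx : L.circleOf σ x ≠ L.circleOf σ (L.arcOut p)) (y : L.Arc) :
    (L.saddle p q).circleOf σ x = (L.saddle p q).circleOf σ y ↔
      L.circleOf σ x = L.circleOf σ y :=
  (h.surg.eq_iff_of_not hx y).symm

/-- **A saddle-merge removes one state circle.** Rasmussen (2010), §4.1; Bar-Natan (2005), §8.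
[cite: Rasmussen2010, §4.1] -/
theorem IsSaddleMerge.circleCount {σ : L.State} (h : L.IsSaddleMerge p q σ) :
    (L.saddle p q).circleCount σ + 1 = L.circleCount σ :=
  h.surg.card_add_one (L.circleOf_surjective σ) ((L.saddle p q).circleOf_surjective σ)

/-- **A saddle-split adds one state circle.** Rasmussen (2010), §4.1; Bar-Natan (2005), §8.
[cite: Rasmussen2010, §4.1] -/
theorem IsSaddleSplit.circleCount {σ : L.State} (h : L.IsSaddleSplit p q σ) :
    (L.saddle p q).circleCount σ = L.circleCount σ + 1 :=
  (h.surg.card_add_one ((L.saddle p q).circleOf_surjective σ) (L.circleOf_surjective σ)).symm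

/-- **The map on circles of a saddle-merge**: each circle of `L` goes to the circle of
`L.saddle p q` containing it (well defined: circles of `L` refine those of `L.saddle p q`,
`KhFace.Surg.le`); it is onto, identifies the circles of `arcOut p` and `arcOut q` and nothing
else (`IsSaddleMerge.surg`). Khovanov (2000), §6 (the cobordism of a saddle).
[cite: Khovanov2000, §6] -/
def IsSaddleMerge.circleMap {σ : L.State} (h : L.IsSaddleMerge p q σ) :
    L.StateCircle σ → (L.saddle p q).StateCircle σ :=
  SimpleGraph.ConnectedComponent.lift (fun a ↦ (L.saddle p q).circleOf σ a)
    fun _ _ w _ ↦ h.surg.le (circleOf_eq_iff_reachable.2 w.reachable)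

/-- The circle map of a saddle-merge on the circle of an arc. [folklore] -/
@[simp]
theorem IsSaddleMerge.circleMap_circleOf {σ : L.State} (h : L.IsSaddleMerge p q σ) (a : L.Arc) :
    h.circleMap (L.circleOf σ a) = (L.saddle p q).circleOf σ a := rfl

/-- The circle map of a saddle-merge is onto. [folklore] -/
theorem IsSaddleMerge.circleMap_surjective {σ : L.State} (h : L.IsSaddleMerge p q σ) :
    Surjective h.circleMap := fun c ↦ by
  obtain ⟨a, rfl⟩ := (L.saddle p q).circleOf_surjective σ c
  exact ⟨L.circleOf σ a, rfl⟩

/-- **The map on circles of a saddle-split**: each circle of `L.saddle p q` goes to the circle of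
`L` containing it; it is onto and identifies exactly the two new circles of the saddle arcs
(`IsSaddleSplit.surg`). Khovanov (2000), §6. [cite: Khovanov2000, §6] -/
def IsSaddleSplit.circleMap {σ : L.State} (h : L.IsSaddleSplit p q σ) :
    (L.saddle p q).StateCircle σ → L.StateCircle σ :=
  SimpleGraph.ConnectedComponent.lift (fun a ↦ L.circleOf σ a)
    fun _ _ w _ ↦ h.surg.le (circleOf_eq_iff_reachable.2 w.reachable)

/-- The circle map of a saddle-split on the circle of an arc. [folklore] -/
@[simp]
theorem IsSaddleSplit.circleMap_circleOf {σ : L.State} (h : L.IsSaddleSplit p q σ) (a : L.Arc) :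
    h.circleMap ((L.saddle p q).circleOf σ a) = L.circleOf σ a := rfl

/-- The circle map of a saddle-split is onto. [folklore] -/
theorem IsSaddleSplit.circleMap_surjective {σ : L.State} (h : L.IsSaddleSplit p q σ) :
    Surjective h.circleMap := fun c ↦ by
  obtain ⟨a, rfl⟩ := L.circleOf_surjective σ c
  exact ⟨(L.saddle p q).circleOf σ a, rfl⟩

end MergeOrSplit


end LinkGaussDiagram

end Literature.Topology.FourManifolds
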